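import Literature.RingTheory.LocalCohomology.CechDepth
import HarnessLib

/-!
# Transfer of vanishing of Čech cohomology along a short exact sequence

Topic `Literature/RingTheory/LocalCohomology`, sequel of `CechComplex.lean` / `CechDepth.lean`.
For a short exact sequence of `R`-modules `0 → M' →φ M →ψ M'' → 0` the Čech complexes with
respect to `y_1,…,y_s` form a degreewise short exact sequence
`0 → Č(y;M') → Č(y;M) → Č(y;M'') → 0` (`cechObjMap_injective/surjective/exact`), whence the long
exact sequence of local cohomology
`0 → H⁰_J(M') → H⁰_J(M) → H⁰_J(M'') → H¹_J(M') → ⋯` (SGA 2 Exp. I–II; Eisenbud, *The Geometry of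
Syzygies*, A1). This file records its **two-out-of-three vanishing** consequences directly on
cocycles (no homology objects, no connecting homomorphism), in the three regimes of the augmented
complex used by `CechDepth.lean` (injectivity of `ε : N → Č⁰(N)` = "`H⁰_J(N) = 0`"; cocycles of
`Č⁰(N)` come from `N` = "`H¹_J(N) = 0`"; cocycles of `Č^{q+1}(N)` are coboundaries =
"`H^{q+2}_J(N) = 0`"):

* `cech_exact_mid_*`   — `Hⁱ(M') = 0` and `Hⁱ(M'') = 0` give `Hⁱ(M) = 0`;
* `cech_exact_right_*` — `Hⁱ(M) = 0` and `Hⁱ⁺¹(M') = 0` give `Hⁱ(M'') = 0`;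
* `cech_exact_left_*`  — `Hⁱ⁻¹(M'') = 0` and `Hⁱ(M) = 0` give `Hⁱ(M') = 0`.

(The special case `M' = M`, `φ = x·`, of `cech_exact_right_*` is the inductive step of
`CechDepthConverse.lean`.) Everything is proved by diagram chasing; no definitions, no named facts.

## References

* [Grothendieck1968SGA2] A. Grothendieck, SGA 2, Exp. I–III (arXiv:math/0511279).
* [Eisenbud2005] D. Eisenbud, *The Geometry of Syzygies*, GTM 229, Appendix 1 (A1.1–A1.3).
-/

noncomputable section

universe u

namespace Literature.RingTheory.LocalCohomology

variable {R : Type u} [CommRing R] {s : ℕ} {y : Fin s → R}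
variable {M' M M'' : Type u} [AddCommGroup M'] [Module R M'] [AddCommGroup M] [Module R M]
  [AddCommGroup M''] [Module R M''] {φ : M' →ₗ[R] M} {ψ : M →ₗ[R] M''}

/-! ## `Hⁱ(M') = 0 ∧ Hⁱ(M'') = 0 ⇒ Hⁱ(M) = 0` -/

/-- `H⁰`: if `ε_{M'}` and `ε_{M''}` are injective then so is `ε_M`.
[cite: Grothendieck1968SGA2, Exp. III 3.3] -/
theorem cech_exact_mid_aug (hφ : Function.Injective φ) (hex : Function.Exact φ ψ)
    (hM' : ∀ m : M', cechAug y M' m = 0 → m = 0) (hM'' : ∀ m : M'', cechAug y M'' m = 0 → m = 0)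
    (m : M) (hm : cechAug y M m = 0) : m = 0 := by
  have h1 : ψ m = 0 := hM'' _ (by rw [cechAug_map, hm, map_zero])
  obtain ⟨a, rfl⟩ := (hex m).mp h1
  have h2 : a = 0 := hM' a (cechObjMap_injective y φ hφ 0 (by rw [← cechAug_map, hm, map_zero]))
  rw [h2, map_zero]

/-- `H¹`: if the cocycles of `Č⁰(M')` and of `Č⁰(M'')` come from `M'`, `M''`, then the cocycles of
`Č⁰(M)` come from `M`. [cite: Grothendieck1968SGA2, Exp. III 3.3] -/
theorem cech_exact_mid_zero (hφ : Function.Injective φ) (hψ : Function.Surjective ψ)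
    (hex : Function.Exact φ ψ)
    (hM' : ∀ c : CechObj y M' 0, dC 0 c = 0 → ∃ m : M', cechAug y M' m = c)
    (hM'' : ∀ c : CechObj y M'' 0, dC 0 c = 0 → ∃ m : M'', cechAug y M'' m = c)
    (c : CechObj y M 0) (hc : dC 0 c = 0) : ∃ m : M, cechAug y M m = c := by
  obtain ⟨m'', hm''⟩ := hM'' (cechObjMap y ψ 0 c) (by rw [dC_cechObjMap, hc, map_zero])
  obtain ⟨m, rfl⟩ := hψ m''
  -- `c - ε m ↦ 0` under `ψ`, so it comes from `M'`
  obtain ⟨a, ha⟩ := ((cechObjMap_exact y φ ψ hex 0) (c - cechAug y M m)).mp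
    (by rw [map_sub, ← cechAug_map, hm'', sub_self])
  have hda : dC 0 a = 0 := cechObjMap_injective y φ hφ 1
    (by rw [← dC_cechObjMap, ha, map_sub, hc, dC_cechAug, sub_self, map_zero])
  obtain ⟨a', rfl⟩ := hM' a hda
  refine ⟨m + φ a', ?_⟩
  rw [map_add, cechAug_map, ha, add_sub_cancel]

/-- `H^{q+2}`: if the cocycles of `Č^{q+1}(M')` and of `Č^{q+1}(M'')` are coboundaries, then so
are the cocycles of `Č^{q+1}(M)`. [cite: Grothendieck1968SGA2, Exp. III 3.3] -/
theorem cech_exact_mid_succ (hφ : Function.Injective φ) (hψ : Function.Surjective ψ)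
    (hex : Function.Exact φ ψ) (q : ℕ)
    (hM' : ∀ c : CechObj y M' (q + 1), dC (q + 1) c = 0 → ∃ b : CechObj y M' q, dC q b = c)
    (hM'' : ∀ c : CechObj y M'' (q + 1), dC (q + 1) c = 0 → ∃ b : CechObj y M'' q, dC q b = c)
    (c : CechObj y M (q + 1)) (hc : dC (q + 1) c = 0) : ∃ b : CechObj y M q, dC q b = c := by
  obtain ⟨b'', hb''⟩ := hM'' (cechObjMap y ψ (q + 1) c) (by rw [dC_cechObjMap, hc, map_zero])
  obtain ⟨b, rfl⟩ := cechObjMap_surjective y ψ hψ q b''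
  obtain ⟨a, ha⟩ := ((cechObjMap_exact y φ ψ hex (q + 1)) (c - dC q b)).mp
    (by rw [map_sub, ← dC_cechObjMap, hb'', sub_self])
  have hda : dC (q + 1) a = 0 := cechObjMap_injective y φ hφ (q + 2)
    (by rw [← dC_cechObjMap, ha, map_sub, hc, dC_dC, sub_self, map_zero])
  obtain ⟨a', rfl⟩ := hM' a hda
  refine ⟨b + cechObjMap y φ q a', ?_⟩
  rw [map_add, dC_cechObjMap, ha, add_sub_cancel]

/-! ## `Hⁱ(M) = 0 ∧ Hⁱ⁺¹(M') = 0 ⇒ Hⁱ(M'') = 0` -/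

/-- `H⁰`: if `ε_M` is injective and the cocycles of `Č⁰(M')` come from `M'`, then `ε_{M''}` is
injective. [cite: Grothendieck1968SGA2, Exp. III 3.3] -/
theorem cech_exact_right_aug (hφ : Function.Injective φ) (hψ : Function.Surjective ψ)
    (hex : Function.Exact φ ψ)
    (hM : ∀ m : M, cechAug y M m = 0 → m = 0)
    (hM' : ∀ c : CechObj y M' 0, dC 0 c = 0 → ∃ m : M', cechAug y M' m = c)
    (m : M'') (hm : cechAug y M'' m = 0) : m = 0 := by
  obtain ⟨m₀, rfl⟩ := hψ m
  obtain ⟨e, he⟩ := ((cechObjMap_exact y φ ψ hex 0) (cechAug y M m₀)).mp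
    (by rw [← cechAug_map, hm])
  have hde : dC 0 e = 0 := cechObjMap_injective y φ hφ 1
    (by rw [← dC_cechObjMap, he, dC_cechAug, map_zero])
  obtain ⟨m', hm'⟩ := hM' e hde
  have h2 : m₀ - φ m' = 0 := hM _ (by rw [map_sub, cechAug_map, hm', he, sub_self])
  rw [sub_eq_zero] at h2
  rw [h2]
  exact hex.apply_apply_eq_zero m'

/-- `H¹`: if the cocycles of `Č⁰(M)` come from `M` and the cocycles of `Č¹(M')` are coboundaries,
then the cocycles of `Č⁰(M'')` come from `M''`. [cite: Grothendieck1968SGA2, Exp. III 3.3] -/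
theorem cech_exact_right_zero (hφ : Function.Injective φ) (hψ : Function.Surjective ψ)
    (hex : Function.Exact φ ψ)
    (hM : ∀ c : CechObj y M 0, dC 0 c = 0 → ∃ m : M, cechAug y M m = c)
    (hM' : ∀ c : CechObj y M' 1, dC 1 c = 0 → ∃ b : CechObj y M' 0, dC 0 b = c)
    (c : CechObj y M'' 0) (hc : dC 0 c = 0) : ∃ m : M'', cechAug y M'' m = c := by
  obtain ⟨c₀, rfl⟩ := cechObjMap_surjective y ψ hψ 0 c
  obtain ⟨e, he⟩ := ((cechObjMap_exact y φ ψ hex 1) (dC 0 c₀)).mp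
    (by rw [← dC_cechObjMap, hc])
  have hde : dC 1 e = 0 := cechObjMap_injective y φ hφ 2
    (by rw [← dC_cechObjMap, he, dC_dC, map_zero])
  obtain ⟨e', rfl⟩ := hM' e hde
  obtain ⟨m, hm⟩ := hM (c₀ - cechObjMap y φ 0 e') (by rw [map_sub, dC_cechObjMap, he, sub_self])
  refine ⟨ψ m, ?_⟩
  rw [cechAug_map, hm, map_sub, sub_eq_self]
  exact funext fun t => by
    rw [cechObjMap_apply, cechObjMap_apply, Pi.zero_apply, locMap, locMap,
      ← LinearMap.comp_apply, ← IsLocalizedModule.map_comp']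
    simp [hex.linearMap_comp_eq_zero]

/-- `H^{q+2}`: if the cocycles of `Č^{q+1}(M)` and of `Č^{q+2}(M')` are coboundaries, then so are
the cocycles of `Č^{q+1}(M'')`. [cite: Grothendieck1968SGA2, Exp. III 3.3] -/
theorem cech_exact_right_succ (hφ : Function.Injective φ) (hψ : Function.Surjective ψ)
    (hex : Function.Exact φ ψ) (q : ℕ)
    (hM : ∀ c : CechObj y M (q + 1), dC (q + 1) c = 0 → ∃ b : CechObj y M q, dC q b = c)
    (hM' : ∀ c : CechObj y M' (q + 2), dC (q + 2) c = 0 →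
      ∃ b : CechObj y M' (q + 1), dC (q + 1) b = c)
    (c : CechObj y M'' (q + 1)) (hc : dC (q + 1) c = 0) :
    ∃ b : CechObj y M'' q, dC q b = c := by
  obtain ⟨c₀, rfl⟩ := cechObjMap_surjective y ψ hψ (q + 1) c
  obtain ⟨e, he⟩ := ((cechObjMap_exact y φ ψ hex (q + 2)) (dC (q + 1) c₀)).mp
    (by rw [← dC_cechObjMap, hc])
  have hde : dC (q + 2) e = 0 := cechObjMap_injective y φ hφ (q + 3)
    (by rw [← dC_cechObjMap, he, dC_dC, map_zero])
  obtain ⟨e', rfl⟩ := hM' e hde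
  obtain ⟨f, hf⟩ := hM (c₀ - cechObjMap y φ (q + 1) e')
    (by rw [map_sub, dC_cechObjMap, he, sub_self])
  refine ⟨cechObjMap y ψ q f, ?_⟩
  rw [dC_cechObjMap, hf, map_sub, sub_eq_self]
  exact ((cechObjMap_exact y φ ψ hex (q + 1)) _).mpr ⟨e', rfl⟩

/-! ## `Hⁱ⁻¹(M'') = 0 ∧ Hⁱ(M) = 0 ⇒ Hⁱ(M') = 0` -/

/-- `H⁰`: if `ε_M` is injective then so is `ε_{M'}`. [cite: Grothendieck1968SGA2, Exp. III 3.3] -/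
theorem cech_exact_left_aug (hφ : Function.Injective φ) (hM : ∀ m : M, cechAug y M m = 0 → m = 0)
    (m : M') (hm : cechAug y M' m = 0) : m = 0 :=
  hφ (by rw [map_zero]; exact hM _ (by rw [cechAug_map, hm, map_zero]))

/-- `H¹`: if `ε_{M''}` is injective and the cocycles of `Č⁰(M)` come from `M`, then the cocycles
of `Č⁰(M')` come from `M'`. [cite: Grothendieck1968SGA2, Exp. III 3.3] -/
theorem cech_exact_left_zero (hφ : Function.Injective φ) (hex : Function.Exact φ ψ)
    (hM'' : ∀ m : M'', cechAug y M'' m = 0 → m = 0)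
    (hM : ∀ c : CechObj y M 0, dC 0 c = 0 → ∃ m : M, cechAug y M m = c)
    (a : CechObj y M' 0) (ha : dC 0 a = 0) : ∃ m : M', cechAug y M' m = a := by
  obtain ⟨m, hm⟩ := hM (cechObjMap y φ 0 a) (by rw [dC_cechObjMap, ha, map_zero])
  have h1 : ψ m = 0 := hM'' _ (by
    rw [cechAug_map, hm]
    exact ((cechObjMap_exact y φ ψ hex 0) _).mpr ⟨a, rfl⟩)
  obtain ⟨a', rfl⟩ := (hex m).mp h1
  exact ⟨a', cechObjMap_injective y φ hφ 0 (by rw [← cechAug_map, hm])⟩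

/-- `H²`: if the cocycles of `Č⁰(M'')` come from `M''` and the cocycles of `Č¹(M)` are
coboundaries, then so are the cocycles of `Č¹(M')`. [cite: Grothendieck1968SGA2, Exp. III 3.3] -/
theorem cech_exact_left_one (hφ : Function.Injective φ) (hψ : Function.Surjective ψ)
    (hex : Function.Exact φ ψ)
    (hM'' : ∀ c : CechObj y M'' 0, dC 0 c = 0 → ∃ m : M'', cechAug y M'' m = c)
    (hM : ∀ c : CechObj y M 1, dC 1 c = 0 → ∃ b : CechObj y M 0, dC 0 b = c)
    (a : CechObj y M' 1) (ha : dC 1 a = 0) : ∃ b : CechObj y M' 0, dC 0 b = a := by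
  obtain ⟨b, hb⟩ := hM (cechObjMap y φ 1 a) (by rw [dC_cechObjMap, ha, map_zero])
  obtain ⟨m'', hm''⟩ := hM'' (cechObjMap y ψ 0 b) (by
    rw [dC_cechObjMap, hb]
    exact ((cechObjMap_exact y φ ψ hex 1) _).mpr ⟨a, rfl⟩)
  obtain ⟨m, rfl⟩ := hψ m''
  obtain ⟨a₀, ha₀⟩ := ((cechObjMap_exact y φ ψ hex 0) (b - cechAug y M m)).mp
    (by rw [map_sub, ← cechAug_map, hm'', sub_self])
  refine ⟨a₀, cechObjMap_injective y φ hφ 1 ?_⟩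
  rw [← dC_cechObjMap, ha₀, map_sub, hb, dC_cechAug, sub_zero]

/-- `H^{q+3}`: if the cocycles of `Č^{q+1}(M'')` and of `Č^{q+2}(M)` are coboundaries, then so
are the cocycles of `Č^{q+2}(M')`. [cite: Grothendieck1968SGA2, Exp. III 3.3] -/
theorem cech_exact_left_succ (hφ : Function.Injective φ) (hψ : Function.Surjective ψ)
    (hex : Function.Exact φ ψ) (q : ℕ)
    (hM'' : ∀ c : CechObj y M'' (q + 1), dC (q + 1) c = 0 → ∃ b : CechObj y M'' q, dC q b = c)
    (hM : ∀ c : CechObj y M (q + 2), dC (q + 2) c = 0 → ∃ b : CechObj y M (q + 1), dC (q + 1) b = c)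
    (a : CechObj y M' (q + 2)) (ha : dC (q + 2) a = 0) :
    ∃ b : CechObj y M' (q + 1), dC (q + 1) b = a := by
  obtain ⟨b, hb⟩ := hM (cechObjMap y φ (q + 2) a) (by rw [dC_cechObjMap, ha, map_zero])
  obtain ⟨b'', hb''⟩ := hM'' (cechObjMap y ψ (q + 1) b) (by
    rw [dC_cechObjMap, hb]
    exact ((cechObjMap_exact y φ ψ hex (q + 2)) _).mpr ⟨a, rfl⟩)
  obtain ⟨b₀, rfl⟩ := cechObjMap_surjective y ψ hψ q b''
  obtain ⟨a₀, ha₀⟩ := ((cechObjMap_exact y φ ψ hex (q + 1)) (b - dC q b₀)).mp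
    (by rw [map_sub, ← dC_cechObjMap, hb'', sub_self])
  refine ⟨a₀, cechObjMap_injective y φ hφ (q + 2) ?_⟩
  rw [← dC_cechObjMap, ha₀, map_sub, hb, dC_dC, sub_zero]

end Literature.RingTheory.LocalCohomology
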